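import Summits.ResolutionOfSingularities.ResolutionOfSingularities.Theses.CleanCovers
import Literature.AlgebraicGeometry.Resolution.NonReducedNoResolution
import Literature.AlgebraicGeometry.Resolution.AbsoluteIntegralClosureNoResolution

/-!
# `CleanCovers.KedlayaReduction`: the conclusion is false without `IsReduced` / without finite type

Negative lemmas of the standing disprover of crux `KedlayaReduction`
(stmt-ResolutionOfSingularities-15241, route `ResolutionOfSingularities/CleanCovers`; work file
`Cruxes/KedlayaReduction/Disproof.lean`). The crux is the implication, for every prime `p`,

  `CoverResolutionAt p → PerfectResolutionAt p`,

whose conclusion `PerfectResolutionAt p` — resolution of every reduced separated scheme of finite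
type over every PERFECT field of characteristic `p` — is verbatim the hypothesis of the shared crux
`DescentPerfectToAll` (stmt-ResolutionOfSingularities-0549). The crux itself is PROVED (candidate
proof attached to the item), so no hypothesis-dropped variant is refutable outright (the antecedent
`CoverResolutionAt p` is open); what CAN be landed is that the conclusion block with one hypothesis
dropped is false at EVERY prime, so that the `IsReduced`-free and the finite-type-free variants of the
crux are each equivalent to `∀ p prime, ¬ CoverResolutionAt p` — the failure of the route's own
rank-2 crux (`Disproof.lean`, `kedlayaReductionWithoutIsReduced_iff`,
`kedlayaReductionWithoutFiniteType_iff`).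

* `kedlayaReduction_conclusion_false_without_isReduced` — witness `Spec 𝔽_p[ε] → Spec 𝔽_p`
  (tree: `not_hasResolution_spec_dualNumber`; `𝔽_p` is perfect).
* `kedlayaReduction_conclusion_false_without_locallyOfFiniteType` — witness `Spec 𝔽_p[X]⁺ → Spec 𝔽_p`,
  the absolute integral closure of the affine line (tree:
  `not_hasResolution_spec_absoluteIntegralClosure`).

These sharpen the tree's `not_resolutionInChar_without_isReduced` /
`not_resolutionInChar_without_locallyOfFiniteType` (stated over all fields of characteristic `p`) to
the perfect-field block quantified by this crux and by `DescentPerfectToAll`.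
-/

noncomputable section

set_option linter.dupNamespace false -- mandated namespace of this single-conjunct summit

open CategoryTheory AlgebraicGeometry Literature.AlgebraicGeometry.Resolution

namespace Summit.ResolutionOfSingularities.ResolutionOfSingularities.Theorems.KedlayaReduction.Negative

/-- **The conclusion of `KedlayaReduction` without `IsReduced X` is false at every prime `p`**:
`Spec 𝔽_p[ε] → Spec 𝔽_p` is affine (separated, quasi-compact) of finite type over the perfect field
`𝔽_p`, and `Spec 𝔽_p[ε]` has no resolution — a dense open of the one-point space is everything, so
the stalk `𝔽_p[ε]` would be a regular local ring, hence a domain (Matsumura Thm. 14.3), but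
`ε ≠ 0 = ε²`. Any proof of the crux must use `IsReduced`. [folklore] -/
theorem kedlayaReduction_conclusion_false_without_isReduced (p : ℕ) (hp : p.Prime) :
    ¬ ∀ (k : Type) [Field k] [CharP k p] [PerfectField k] (X : Scheme.{0}) (f : X ⟶ Spec (.of k)),
      IsSeparated f → LocallyOfFiniteType f → QuasiCompact f → Scheme.HasResolution X := by
  haveI : Fact p.Prime := ⟨hp⟩
  intro h
  haveI : Module.Finite (ZMod p) (DualNumber (ZMod p)) :=
    inferInstanceAs (Module.Finite (ZMod p) (ZMod p × ZMod p))
  let f : Spec (.of (DualNumber (ZMod p))) ⟶ Spec (.of (ZMod p)) :=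
    Spec.map (CommRingCat.ofHom (algebraMap (ZMod p) (DualNumber (ZMod p))))
  haveI : LocallyOfFiniteType f :=
    (HasRingHomProperty.Spec_iff (P := @LocallyOfFiniteType)).mpr
      (RingHom.finiteType_algebraMap.mpr inferInstance)
  exact not_hasResolution_spec_dualNumber (ZMod p)
    (h (ZMod p) (Spec (.of (DualNumber (ZMod p)))) f inferInstance inferInstance inferInstance)

open Polynomial in
/-- **The conclusion of `KedlayaReduction` without `LocallyOfFiniteType f` is false at every prime
`p`**: `Spec 𝔽_p[X]⁺ → Spec 𝔽_p` (the absolute integral closure of the affine line over the perfect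
field `𝔽_p`: affine, reduced) has no resolution — a dense open of `Spec` of a root-closed domain
with non-open generic point contains a non-generic point, whose stalk would be regular, in particular
Noetherian, which forces it to be generic. Any proof of the crux must use finite type. [folklore] -/
theorem kedlayaReduction_conclusion_false_without_locallyOfFiniteType (p : ℕ) (hp : p.Prime) :
    ¬ ∀ (k : Type) [Field k] [CharP k p] [PerfectField k] (X : Scheme.{0}) (f : X ⟶ Spec (.of k)),
      IsSeparated f → QuasiCompact f → IsReduced X → Scheme.HasResolution X := by
  haveI : Fact p.Prime := ⟨hp⟩
  intro h
  let f : Spec (.of ↥(integralClosure (ZMod p)[X] (AlgebraicClosure (RatFunc (ZMod p))))) ⟶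
      Spec (.of (ZMod p)) :=
    Spec.map (CommRingCat.ofHom ((algebraMap (ZMod p)[X]
      ↥(integralClosure (ZMod p)[X] (AlgebraicClosure (RatFunc (ZMod p))))).comp Polynomial.C))
  exact not_hasResolution_spec_absoluteIntegralClosure p
    (h (ZMod p) _ f inferInstance inferInstance inferInstance)

end Summit.ResolutionOfSingularities.ResolutionOfSingularities.Theorems.KedlayaReduction.Negative

end
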